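import Summits.KontsevichZagierPeriods.KontsevichZagierPeriods.Theorems.RootDecompZetaThreeFrontierGZLadderFourPolarP08

/-! # `RootDecompZetaThreeFrontierGZLadderFourPolarP09` — part 9/12 of the mechanical ≤400-line split of `l4_src.lean` (sha256 5cc5a9ee4c47da9a…)
Source: decomp-kz lens-1 g13 Layer4_v1.lean @897236f9 minus the RungFour prelude block (imported from …RungFourPreludeP14); --supports stmt-KontsevichZagierPeriods-27141.
Split by census-1 g10 `gen/splitlean.py`: scopes re-opened with their `open`/`variable`/`set_option` context; mathematics and declaration order unchanged. -/

set_option linter.dupNamespace false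
noncomputable section
set_option linter.dupNamespace false
set_option linter.unusedVariables false
set_option linter.unusedSectionVars false
set_option linter.unusedSimpArgs false
open Set MeasureTheory MvPolynomial
open Literature.NumberTheory.Transcendental
open Summit.KontsevichZagierPeriods.KontsevichZagierPeriods.Theorems.RootDecompZetaThreeFrontierWordMoves
/-- Auxiliary step `mem_simplex_four_iff` (§W5): mem simplex four iff. [bookkeeping] -/
private theorem mem_simplex_four_iff (t : Fin 4 → ℝ) :
    t ∈ KZ.openOrderedSimplex 4 ↔ 0 < t 3 ∧ t 3 < t 2 ∧ t 2 < t 1 ∧ t 1 < t 0 ∧ t 0 < 1 := by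
  constructor
  · rintro ⟨h0, h1, ha⟩
    exact ⟨h0 3, ha (show (2 : Fin 4) < 3 by decide), ha (show (1 : Fin 4) < 2 by decide),
      ha (show (0 : Fin 4) < 1 by decide), h1 0⟩
  · rintro ⟨h3, h32, h21, h10, h0⟩
    have hsa : StrictAnti t := by
      refine Fin.strictAnti_iff_succ_lt.mpr fun i => ?_
      fin_cases i
      · simpa using h10
      · simpa using h21
      · simpa using h32
    exact ⟨fun i => lt_of_lt_of_le h3 (hsa.antitone (Fin.le_last i)),
      fun i => lt_of_le_of_lt (hsa.antitone (Fin.le_iff_val_le_val.2 (Nat.zero_le _))) h0, hsa⟩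

/-- Auxiliary step `exists_measurableEquiv_snoc` (§W1): exists measurable Equiv snoc. [bookkeeping] -/
private theorem exists_measurableEquiv_snoc (N : ℕ) :
    ∃ e : (Fin (N + 1) → ℝ) ≃ᵐ (Fin N → ℝ) × ℝ,
      MeasurePreserving e volume ((volume : Measure (Fin N → ℝ)).prod (volume : Measure ℝ)) ∧
      ∀ q, e.symm q = Fin.snoc q.1 q.2 := by
  refine ⟨(MeasurableEquiv.piFinSuccAbove (fun _ => ℝ) (Fin.last N)).trans
    MeasurableEquiv.prodComm, ?_, fun q => ?_⟩
  · refine (volume_preserving_piFinSuccAbove (fun _ => ℝ) (Fin.last N)).trans ?_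
    rw [Measure.volume_eq_prod]
    exact Measure.measurePreserving_swap
  · show (MeasurableEquiv.piFinSuccAbove (fun _ => ℝ) (Fin.last N)).symm (q.2, q.1) = _
    rw [MeasurableEquiv.piFinSuccAbove_symm_apply, Fin.insertNthEquiv_last]
    rfl

namespace Summit.KontsevichZagierPeriods.KontsevichZagierPeriods.Cruxes.GZNormalFormWThree.GZLadder.SuffFour
open Summit.KontsevichZagierPeriods.KontsevichZagierPeriods.Cruxes.GZNormalFormWThree.GZLadder.RungFour
open Summit.KontsevichZagierPeriods.KontsevichZagierPeriods.Cruxes.GZNormalFormWThree.GZLadder.WlogFour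
open Summit.KontsevichZagierPeriods.KontsevichZagierPeriods.Cruxes.GZNormalFormWThree.GZLadder.MatchFour
open Summit.KontsevichZagierPeriods.KontsevichZagierPeriods.Cruxes.GZNormalFormWThree.GZLadder.GapForm
open Summit.KontsevichZagierPeriods.KontsevichZagierPeriods.Cruxes.GZNormalFormWThree.GZLadder.OrdFour
open Summit.KontsevichZagierPeriods.RootDecompZetaThreeFrontier.WordLayer (one_div_pow_le_rpow2 one_div_pow_le_rpow3
  rpow_mul_rpow_le_max_rpow rpow3_le_max_rpow integrableOn_one_sub_rpow collect2 collect3)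

open Set MeasureTheory MvPolynomial in
open Literature.NumberTheory.Transcendental in
open Summit.KontsevichZagierPeriods.KontsevichZagierPeriods.Theorems.RootDecompZetaThreeFrontierWordMoves in

open Set MeasureTheory MvPolynomial in
open Literature.NumberTheory.Transcendental in
open Summit.KontsevichZagierPeriods.KontsevichZagierPeriods.Theorems.RootDecompZetaThreeFrontierWordMoves in

/-- Auxiliary step `gapF4_chart_nonneg`: gap F4 chart nonneg. [bookkeeping] -/
theorem gapF4_chart_nonneg (κ : Fin 5 →₀ ℕ) (β₀ β₁ β₂ γ₁ γ₂ γ₃ α₀₂ α₀₃ α₁₃ : ℕ) {y : Fin 4 → ℝ} (hy : y ∈ Cube4) :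
    0 ≤ y 3 ^ 3 * y 0 ^ 2 * y 1 * gapF4 κ β₀ β₁ β₂ γ₁ γ₂ γ₃ α₀₂ α₀₃ α₁₃ (cΨ y) := by
  obtain ⟨h0, h01, h1, h11, h2, h21, h3, h31⟩ := hy
  obtain ⟨g0, g1, g2, g3, g4, g5, g6, g7, g8, g9, g10, g11, g12, g13⟩ :=
    gz4_denoms_pos (cΨ_mem ⟨h0, h01, h1, h11, h2, h21, h3, h31⟩)
  have : 0 ≤ gapF4 κ β₀ β₁ β₂ γ₁ γ₂ γ₃ α₀₂ α₀₃ α₁₃ (cΨ y) := by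
    unfold gapF4
    positivity
  positivity

/-! ### §S4 The far-corner part routed; the theorem -/

/-- the far-corner part routed: `gapW4 ≤ ∏ (1-yᵢ)^{Aᵢ}`,
`A = (κ₁-b1-c1-g1-d1-e1, κ₂-c2-g2-d2-e2-f2, κ₃-g3-e3-f3, κ₀-b0-c0-g0)` -/
theorem gapW4_le (κ : Fin 5 →₀ ℕ) (γ₁ γ₂ γ₃ α₀₂ α₀₃ α₁₃ : ℕ) {b0 b1 c0 c1 c2 g0 g1 g2 g3 d1 d2 e1 e2 e3 f2 f3 : ℝ}
    (hb0 : 0 ≤ b0) (hb1 : 0 ≤ b1) (hc0 : 0 ≤ c0) (hc1 : 0 ≤ c1) (hc2 : 0 ≤ c2) (hg0 : 0 ≤ g0) (hg1 : 0 ≤ g1)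
    (hg2 : 0 ≤ g2) (hg3 : 0 ≤ g3) (hd1 : 0 ≤ d1) (hd2 : 0 ≤ d2) (he1 : 0 ≤ e1) (he2 : 0 ≤ e2) (he3 : 0 ≤ e3)
    (hf2 : 0 ≤ f2) (hf3 : 0 ≤ f3) (sb : b0 + b1 = γ₁) (sc : c0 + c1 + c2 = γ₂) (sg : g0 + g1 + g2 + g3 = γ₃)
    (sd : d1 + d2 = α₀₂) (se : e1 + e2 + e3 = α₀₃) (sf : f2 + f3 = α₁₃) {y : Fin 4 → ℝ} (hy : y ∈ Cube4) :
    gapW4 κ γ₁ γ₂ γ₃ α₀₂ α₀₃ α₁₃ y ≤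
      ∏ i, (1 - y i) ^ (![(κ 1 : ℝ) - b1 - c1 - g1 - d1 - e1, (κ 2 : ℝ) - c2 - g2 - d2 - e2 - f2,
        (κ 3 : ℝ) - g3 - e3 - f3, (κ 0 : ℝ) - b0 - c0 - g0] : Fin 4 → ℝ) i := by
  obtain ⟨h0, h01, h1, h11, h2, h21, h3, h31⟩ := hy
  obtain ⟨u0, u1, u2, u3, p30, p301, p3012, p01, p012, p12⟩ := cube4_facts ⟨h0, h01, h1, h11, h2, h21, h3, h31⟩
  have Bγ₁ : 1 / (1 - y 3 * y 0) ^ γ₁ ≤ (1 - y 3) ^ (-b0) * (1 - y 0) ^ (-b1) :=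
    one_div_pow_le_rpow2 h3.le h31 h0.le h01 hb0 hb1 sb
  have Bγ₂ : 1 / (1 - y 3 * y 0 * y 1) ^ γ₂ ≤ (1 - y 3) ^ (-c0) * (1 - y 0) ^ (-c1) * (1 - y 1) ^ (-c2) :=
    one_div_pow_le_rpow3 h3.le h31 h0.le h01 h1.le h11 hc0 hc1 hc2 sc
  have Bγ₃ : 1 / (1 - y 3 * y 0 * y 1 * y 2) ^ γ₃ ≤
      (1 - y 3) ^ (-g0) * (1 - y 0) ^ (-g1) * (1 - y 1) ^ (-g2) * (1 - y 2) ^ (-g3) :=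
    one_div_pow_le_rpow4 h3.le h31 h0.le h01 h1.le h11 h2.le h21 hg0 hg1 hg2 hg3 sg
  have Bα₀₂ : 1 / (1 - y 0 * y 1) ^ α₀₂ ≤ (1 - y 0) ^ (-d1) * (1 - y 1) ^ (-d2) :=
    one_div_pow_le_rpow2 h0.le h01 h1.le h11 hd1 hd2 sd
  have Bα₀₃ : 1 / (1 - y 0 * y 1 * y 2) ^ α₀₃ ≤ (1 - y 0) ^ (-e1) * (1 - y 1) ^ (-e2) * (1 - y 2) ^ (-e3) :=
    one_div_pow_le_rpow3 h0.le h01 h1.le h11 h2.le h21 he1 he2 he3 se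
  have Bα₁₃ : 1 / (1 - y 1 * y 2) ^ α₁₃ ≤ (1 - y 1) ^ (-f2) * (1 - y 2) ^ (-f3) :=
    one_div_pow_le_rpow2 h1.le h11 h2.le h21 hf2 hf3 sf
  have N0 : 0 ≤ (1 - y 3) ^ κ 0 * (1 - y 0) ^ κ 1 * (1 - y 1) ^ κ 2 * (1 - y 2) ^ κ 3 := by positivity
  have hy2 : y 2 ^ κ 4 ≤ 1 := pow_le_one₀ h2.le h21.le
  have step1 : gapW4 κ γ₁ γ₂ γ₃ α₀₂ α₀₃ α₁₃ y ≤
      ((1 - y 3) ^ κ 0 * (1 - y 0) ^ κ 1 * (1 - y 1) ^ κ 2 * (1 - y 2) ^ κ 3) *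
      (1 / (1 - y 3 * y 0) ^ γ₁) * (1 / (1 - y 3 * y 0 * y 1) ^ γ₂) * (1 / (1 - y 3 * y 0 * y 1 * y 2) ^ γ₃) *
      (1 / (1 - y 0 * y 1) ^ α₀₂) * (1 / (1 - y 0 * y 1 * y 2) ^ α₀₃) * (1 / (1 - y 1 * y 2) ^ α₁₃) := by
    unfold gapW4
    rw [show y 2 ^ κ 4 * ((1 - y 3) ^ κ 0 * (1 - y 0) ^ κ 1 * (1 - y 1) ^ κ 2 * (1 - y 2) ^ κ 3) /
        ((1 - y 3 * y 0) ^ γ₁ * (1 - y 3 * y 0 * y 1) ^ γ₂ * (1 - y 3 * y 0 * y 1 * y 2) ^ γ₃ * (1 - y 0 * y 1) ^ α₀₂ *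
          (1 - y 0 * y 1 * y 2) ^ α₀₃ * (1 - y 1 * y 2) ^ α₁₃) =
        y 2 ^ κ 4 * (((1 - y 3) ^ κ 0 * (1 - y 0) ^ κ 1 * (1 - y 1) ^ κ 2 * (1 - y 2) ^ κ 3) *
      (1 / (1 - y 3 * y 0) ^ γ₁) * (1 / (1 - y 3 * y 0 * y 1) ^ γ₂) * (1 / (1 - y 3 * y 0 * y 1 * y 2) ^ γ₃) *
      (1 / (1 - y 0 * y 1) ^ α₀₂) * (1 / (1 - y 0 * y 1 * y 2) ^ α₀₃) * (1 / (1 - y 1 * y 2) ^ α₁₃)) by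
        field_simp]
    exact mul_le_of_le_one_left (by positivity) hy2
  refine step1.trans ?_
  calc ((1 - y 3) ^ κ 0 * (1 - y 0) ^ κ 1 * (1 - y 1) ^ κ 2 * (1 - y 2) ^ κ 3) *
      (1 / (1 - y 3 * y 0) ^ γ₁) * (1 / (1 - y 3 * y 0 * y 1) ^ γ₂) * (1 / (1 - y 3 * y 0 * y 1 * y 2) ^ γ₃) *
      (1 / (1 - y 0 * y 1) ^ α₀₂) * (1 / (1 - y 0 * y 1 * y 2) ^ α₀₃) * (1 / (1 - y 1 * y 2) ^ α₁₃)
        ≤ ((1 - y 3) ^ κ 0 * (1 - y 0) ^ κ 1 * (1 - y 1) ^ κ 2 * (1 - y 2) ^ κ 3) *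
      ((1 - y 3) ^ (-b0) * (1 - y 0) ^ (-b1)) * ((1 - y 3) ^ (-c0) * (1 - y 0) ^ (-c1) * (1 - y 1) ^ (-c2)) *
      ((1 - y 3) ^ (-g0) * (1 - y 0) ^ (-g1) * (1 - y 1) ^ (-g2) * (1 - y 2) ^ (-g3)) *
      ((1 - y 0) ^ (-d1) * (1 - y 1) ^ (-d2)) * ((1 - y 0) ^ (-e1) * (1 - y 1) ^ (-e2) * (1 - y 2) ^ (-e3)) *
      ((1 - y 1) ^ (-f2) * (1 - y 2) ^ (-f3)) := by gcongr
    _ = ((1 - y 0) ^ κ 1 * (1 - y 0) ^ (-b1) * (1 - y 0) ^ (-c1) * (1 - y 0) ^ (-g1) * (1 - y 0) ^ (-d1) *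
          (1 - y 0) ^ (-e1)) *
        ((1 - y 1) ^ κ 2 * (1 - y 1) ^ (-c2) * (1 - y 1) ^ (-g2) * (1 - y 1) ^ (-d2) * (1 - y 1) ^ (-e2) *
          (1 - y 1) ^ (-f2)) *
        ((1 - y 2) ^ κ 3 * (1 - y 2) ^ (-g3) * (1 - y 2) ^ (-e3) * (1 - y 2) ^ (-f3)) *
        ((1 - y 3) ^ κ 0 * (1 - y 3) ^ (-b0) * (1 - y 3) ^ (-c0) * (1 - y 3) ^ (-g0)) := by ring
    _ = ∏ i, (1 - y i) ^ (![(κ 1 : ℝ) - b1 - c1 - g1 - d1 - e1, (κ 2 : ℝ) - c2 - g2 - d2 - e2 - f2,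
        (κ 3 : ℝ) - g3 - e3 - f3, (κ 0 : ℝ) - b0 - c0 - g0] : Fin 4 → ℝ) i := by
        rw [collect5 u0, collect5 u1, collect3 u2, collect3 u3, prod_four_rpow]
        simp only [Matrix.cons_val_zero, Matrix.cons_val_one, Matrix.head_cons, Matrix.cons_val_two, Matrix.tail_cons,
          Matrix.cons_val_three]

/-- Auxiliary step `continuousOn_gapF4` (§S4): continuous On gap F4. [bookkeeping] -/
theorem continuousOn_gapF4 (κ : Fin 5 →₀ ℕ) (β₀ β₁ β₂ γ₁ γ₂ γ₃ α₀₂ α₀₃ α₁₃ : ℕ) :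
    ContinuousOn (gapF4 κ β₀ β₁ β₂ γ₁ γ₂ γ₃ α₀₂ α₀₃ α₁₃) (KZ.openOrderedSimplex 4) := by
  refine (Continuous.continuousOn (by fun_prop)).div (Continuous.continuousOn (by fun_prop)) fun t ht => ?_
  obtain ⟨g0, g1, g2, g3, g4, g5, g6, g7, g8, g9, g10, g11, g12, g13⟩ := gz4_denoms_pos ht
  positivity

/-- **THE CONVERGENCE ENGINE IN DIMENSION 4** (sector criterion, sufficiency): under the nine cluster conditions of `Admissible4`
the gap class `g^κ / (t₀^{β₀} t₁^{β₁} t₂^{β₂} (1-t₁)^{γ₁} (1-t₂)^{γ₂} (1-t₃)^{γ₃} (t₀-t₂)^{α₀₂} (t₀-t₃)^{α₀₃} (t₁-t₃)^{α₁₃})`,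
`g = (1-t₀, t₀-t₁, t₁-t₂, t₂-t₃, t₃)`, is absolutely integrable on `Δ₄`. -/
theorem gapClass4_integrableOn (κ : Fin 5 →₀ ℕ) {β₀ β₁ β₂ γ₁ γ₂ γ₃ α₀₂ α₀₃ α₁₃ : ℕ}
    (h : Admissible4 κ β₀ β₁ β₂ γ₁ γ₂ γ₃ α₀₂ α₀₃ α₁₃) :
    IntegrableOn (gapF4 κ β₀ β₁ β₂ γ₁ γ₂ γ₃ α₀₂ α₀₃ α₁₃) (KZ.openOrderedSimplex 4) := by
  obtain ⟨hV1, hV2, hV3, H0123, H012, H01, H12, H123, H23⟩ := h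
  obtain ⟨b0, b1, c0, c1, c2, g0, g1, g2, g3, d1, d2, e1, e2, e3, f2, f3, hb0, hb1, hc0, hc1, hc2, hg0, hg1, hg2, hg3,
    hd1, hd2, he1, he2, he3, hf2, hf3, sb, sc, sg, sd, se, sf, L0, L1, L2, L3⟩ :=
    routing4 (κ 0) (κ 1) (κ 2) (κ 3) γ₁ γ₂ γ₃ α₀₂ α₀₃ α₁₃ H01 H12 H23 H012 H123 H0123
  set A : Fin 4 → ℝ := ![(κ 1 : ℝ) - b1 - c1 - g1 - d1 - e1, (κ 2 : ℝ) - c2 - g2 - d2 - e2 - f2,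
    (κ 3 : ℝ) - g3 - e3 - f3, (κ 0 : ℝ) - b0 - c0 - g0] with hA_def
  have hA : ∀ i, -1 < A i := by
    intro i
    fin_cases i
    · show -1 < (κ 1 : ℝ) - b1 - c1 - g1 - d1 - e1
      linarith
    · show -1 < (κ 2 : ℝ) - c2 - g2 - d2 - e2 - f2
      linarith
    · show -1 < (κ 3 : ℝ) - g3 - e3 - f3
      linarith
    · show -1 < (κ 0 : ℝ) - b0 - c0 - g0
      linarith
  have hG : ContinuousOn (fun y => y 3 ^ 3 * y 0 ^ 2 * y 1 * gapF4 κ β₀ β₁ β₂ γ₁ γ₂ γ₃ α₀₂ α₀₃ α₁₃ (cΨ y)) Cube4 :=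
    (Continuous.continuousOn (by fun_prop)).mul
      ((continuousOn_gapF4 κ β₀ β₁ β₂ γ₁ γ₂ γ₃ α₀₂ α₀₃ α₁₃).comp continuous_cΨ.continuousOn fun y hy => cΨ_mem hy)
  refine integrableOn_of_cchart (integrableOn_cube4_of_le hG A hA fun y hy => ?_)
  rw [abs_of_nonneg (gapF4_chart_nonneg κ β₀ β₁ β₂ γ₁ γ₂ γ₃ α₀₂ α₀₃ α₁₃ hy)]
  exact (gapF4_chart_le κ hV1 hV2 hV3 hy).trans
    (gapW4_le κ γ₁ γ₂ γ₃ α₀₂ α₀₃ α₁₃ hb0 hb1 hc0 hc1 hc2 hg0 hg1 hg2 hg3 hd1 hd2 he1 he2 he3 hf2 hf3 sb sc sg sd se sf hy)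

/-- **S₄ PROVED.** -/
theorem gapClassIntegrableFour : GapClassIntegrableFour :=
  fun κ β₀ β₁ β₂ γ₁ γ₂ γ₃ α₀₂ α₀₃ α₁₃ h => gapClass4_integrableOn κ h

/-- **MATCH₄ PROVED up to the layer step**: every reduced dimension-4 datum is congruent into `layerFour ∪ gzLT 4`
(N₄, E₄, S₄ all discharged). -/
theorem match_four : ∀ r : KZ.IntegralRep 4, IsReducedFour r → CongInto (layerFour ∪ gzLT 4) (KZ.of r) :=
  match_four_of_suff gapClassIntegrableFour

/-- **(A₄) ⟸ LAYER₄** — the polar reduction of rung 4 follows from the LAYER STEP ALONE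
(`∀ s, IsLayerFour s → CongInto (cellGens 4 ∪ gzLT 4) (KZ.of s)`: pure move calculus, k = 3 template `stub_three_layer`). -/
theorem polarReduction_four_of_LAYER
    (h₅ : ∀ s : KZ.IntegralRep 4, IsLayerFour s → CongInto (cellGens 4 ∪ gzLT 4) (KZ.of s)) : PolarReduction 4 :=
  polarReduction_four_of_S_LAYER gapClassIntegrableFour h₅

end Summit.KontsevichZagierPeriods.KontsevichZagierPeriods.Cruxes.GZNormalFormWThree.GZLadder.SuffFour

/-! # §L  LAYER₄ — FIRST ENGINES (decomp-kz lens-1 g13): Newton–Leibniz in `t₃` over `Δ₃` (`nlB4`), the duality move `σ₄` on `Δ₄`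
for ANY integrand, and the two DISPOSAL ENGINES of the layer step: a layer class with NO FAR `t₃`-POLES (`γ₃ = α₀₃ = α₁₃ = 0`) is
congruent to ONE genus-zero datum of dimension 3 (one NL move with the incomplete-Beta primitive
`∫₀^{t₃} (t₂-s)^{κ₃} s^{κ₄} ds = ∑ₘ (-1)^m C(κ₃,m)/(κ₄+m+1) · t₂^{κ₃-m} t₃^{κ₄+m+1}`, whose value on the face `t₃ = t₂` is
`B(κ₃+1,κ₄+1)·t₂^{κ₃+κ₄+1}` — the output is the k = 3 GAP CLASS `q B · g₀^{κ₀} g₁^{κ₁} g₂^{κ₂} t₂^{κ₃+κ₄+1-β₂}/(t₀^{β₀} t₁^{β₁}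
(1-t₁)^{γ₁} (1-t₂)^{γ₂} (t₀-t₂)^{α₀₂})`, polynomial by the cluster bound `β₂ ≤ κ₃+κ₄+1` = `Admissible4` (3)), and dually a class with
NO FAR `t₀`-POLES (`β₀ = α₀₂ = α₀₃ = 0`, bound `γ₁ ≤ κ₀+κ₁+1` = `Admissible4` (6)).  What remains of LAYER₄ after §L is the class of
layer data with at least one far pole in `t₃` AND at least one far pole in `t₀` (RUNG4 §25). -/

namespace Summit.KontsevichZagierPeriods.KontsevichZagierPeriods.Cruxes.GZNormalFormWThree.GZLadder.LayerFour

open Summit.KontsevichZagierPeriods.KontsevichZagierPeriods.Cruxes.GZNormalFormWThree.GZLadder.RungFour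
open Summit.KontsevichZagierPeriods.KontsevichZagierPeriods.Cruxes.GZNormalFormWThree.GZLadder.WlogFour
open Summit.KontsevichZagierPeriods.KontsevichZagierPeriods.Cruxes.GZNormalFormWThree.GZLadder.MatchFour
open Summit.KontsevichZagierPeriods.KontsevichZagierPeriods.Cruxes.GZNormalFormWThree.GZLadder.GapForm
open Literature.ModelTheory.ExponentialFields (IsSemialgebraic)

/-! ### §L1 The band `0 ≤ t₃ ≤ t₂` over `Δ₃` and Newton–Leibniz in `t₃` (port of `WordLayer.bandB3` / `nlB3`) -/

/-- the closed band `0 ≤ t₃ ≤ t₂` over `Δ₃` -/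
def bandB4 : Set (Fin 4 → ℝ) :=
  KZlog.band (KZ.openOrderedSimplex 3) (fun _ : Fin 3 → ℝ => (0 : ℝ)) (fun y : Fin 3 → ℝ => y (Fin.last 2))

/-- Auxiliary step `mem_bandB4_iff` (§L1): mem band B4 iff. [bookkeeping] -/
theorem mem_bandB4_iff (z : Fin 4 → ℝ) :
    z ∈ bandB4 ↔ (0 < z 2 ∧ z 2 < z 1 ∧ z 1 < z 0 ∧ z 0 < 1) ∧ 0 ≤ z 3 ∧ z 3 ≤ z 2 := by
  rw [bandB4, KZlog.mem_band, mem_simplex_three_iff]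
  exact Iff.rfl

/-- Auxiliary step `bandB4_facts` (§L1): band B4 facts. [bookkeeping] -/
theorem bandB4_facts {z : Fin 4 → ℝ} (hz : z ∈ bandB4) :
    z 0 ≠ 0 ∧ z 1 ≠ 0 ∧ z 2 ≠ 0 ∧ (1 : ℝ) - z 1 ≠ 0 ∧ (1 : ℝ) - z 2 ≠ 0 ∧ z 0 - z 2 ≠ 0 := by
  obtain ⟨⟨h2, h21, h10, h0⟩, -, -⟩ := (mem_bandB4_iff z).1 hz
  exact ⟨by linarith, by linarith, by linarith, by linarith, by linarith, by linarith⟩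

/-- `bandB4` is `ℚ`-semialgebraic. [BCR1998 §2.2] -/
theorem isSemialgebraic_bandB4 : IsSemialgebraic ℚ bandB4 := by
  have hτ := KZ.isSemialgebraic_openOrderedSimplex 3
  exact KZlog.isSemialgebraic_band
    ((isSemialgebraicFunOn_aeval hτ (0 : MvPolynomial (Fin 3) ℚ)).congr fun y _ => by simp)
    ((isSemialgebraicFunOn_aeval hτ (MvPolynomial.X (Fin.last 2))).congr fun y _ => by simp)

/-- `Δ₄` as the open band `0 < t₃ < t₂` over `Δ₃` -/
theorem simplex4_eq_openBand : KZ.openOrderedSimplex 4 =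
    {z : Fin 4 → ℝ | (Fin.init z : Fin 3 → ℝ) ∈ KZ.openOrderedSimplex 3 ∧ (fun _ : Fin 3 → ℝ => (0 : ℝ)) (Fin.init z) < z (Fin.last 3) ∧
      z (Fin.last 3) < (fun y : Fin 3 → ℝ => y (Fin.last 2)) (Fin.init z : Fin 3 → ℝ)} := by
  ext z
  rw [mem_simplex_four_iff]
  simp only [mem_setOf_eq, mem_simplex_three_iff]
  rw [show (Fin.init z : Fin 3 → ℝ) 0 = z 0 from rfl, show (Fin.init z : Fin 3 → ℝ) 1 = z 1 from rfl,
    show (Fin.init z : Fin 3 → ℝ) 2 = z 2 from rfl, show (Fin.init z : Fin 3 → ℝ) (Fin.last 2) = z 2 from rfl,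
    show z (Fin.last 3) = z 3 from rfl]
  constructor
  · rintro ⟨h3, h32, h21, h10, h0⟩; exact ⟨⟨h3.trans h32, h21, h10, h0⟩, h3, h32⟩
  · rintro ⟨⟨-, h21, h10, h0⟩, h3, h32⟩; exact ⟨h3, h32, h21, h10, h0⟩

/-- **Newton–Leibniz over an open band, packaged** (verbatim copy of the landed private
`WordLayer.newtonLeibniz_pack` = `JanusBands.IntegrateOut.newtonLeibniz_pack`, with the public `WlogFour.exists_measurableEquiv_snoc`).
[Kontsevich–Zagier 2001, §1.2, rule (3)] [folklore] -/
private theorem newtonLeibniz_pack4 {N : ℕ} {τ : Set (Fin N → ℝ)} (hτ : IsSemialgebraic ℚ τ)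
    {a b : (Fin N → ℝ) → ℝ} (ha : IsSemialgebraicFunOn ℚ τ a) (hb : IsSemialgebraicFunOn ℚ τ b)
    (hab : ∀ x ∈ τ, a x < b x) {f F : (Fin (N + 1) → ℝ) → ℝ}
    (hf : IsSemialgebraicFunOn ℚ (KZlog.band τ a b) f)
    (hF : IsSemialgebraicFunOn ℚ (KZlog.band τ a b) F)
    (hcont : ∀ x ∈ τ, ContinuousOn (fun t => F (Fin.snoc x t)) (Icc (a x) (b x)))
    (hder : ∀ x ∈ τ, ∀ t ∈ Ioo (a x) (b x),
      HasDerivAt (fun s => F (Fin.snoc x s)) (f (Fin.snoc x t)) t)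
    (r : KZ.IntegralRep (N + 1))
    (hrd : r.domain = {z | (Fin.init z : Fin N → ℝ) ∈ τ ∧ a (Fin.init z) < z (Fin.last N) ∧
      z (Fin.last N) < b (Fin.init z)})
    (hri : EqOn r.integrand f r.domain) :
    ∃ r' : KZ.IntegralRep N, r'.domain = τ ∧
      (r'.integrand = fun x => F (Fin.snoc x (b x)) - F (Fin.snoc x (a x))) ∧
      KZ.of r - KZ.of r' ∈ KZ.relations := by
  have hτm : MeasurableSet τ := IsSemialgebraic.measurableSet_holds hτ
  have hBsa : IsSemialgebraic ℚ (KZlog.band τ a b) := KZlog.isSemialgebraic_band ha hb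
  have hBm : MeasurableSet (KZlog.band τ a b) := IsSemialgebraic.measurableSet_holds hBsa
  have hsub : r.domain ⊆ KZlog.band τ a b := by
    rw [hrd]; exact fun z hz => ⟨hz.1, hz.2.1.le, hz.2.2.le⟩
  have hdiff : KZlog.band τ a b \ r.domain ⊆
      {z | (Fin.init z : Fin N → ℝ) ∈ τ ∧ z (Fin.last N) = a (Fin.init z)} ∪
        {z | (Fin.init z : Fin N → ℝ) ∈ τ ∧ z (Fin.last N) = b (Fin.init z)} := by
    rw [hrd]
    rintro z ⟨⟨hzτ, h1, h2⟩, hz⟩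
    simp only [mem_setOf_eq, not_and, not_lt] at hz
    rcases h1.lt_or_eq with h1 | h1
    · exact Or.inr ⟨hzτ, le_antisymm h2 (hz hzτ h1)⟩
    · exact Or.inl ⟨hzτ, h1.symm⟩
  have hnull : volume (KZlog.band τ a b \ r.domain) = 0 :=
    measure_mono_null hdiff (measure_union_null (KZ.volume_graph_eq_zero ha)
      (KZ.volume_graph_eq_zero hb))
  have hfO : IntegrableOn f r.domain :=
    r.integrableOn.congr_fun hri (KZ.IntegralRep.measurableSet_domain_holds r)
  have hfB : IntegrableOn f (KZlog.band τ a b) := by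
    rw [← Set.union_sdiff_cancel hsub]
    exact integrableOn_union.mpr ⟨hfO, IntegrableOn.of_measure_zero hnull⟩
  let r₂ : KZ.IntegralRep (N + 1) := ⟨KZlog.band τ a b, f, hBsa, hf, hfB⟩
  have h12 : KZ.of r - KZ.of r₂ ∈ KZ.relations := by
    refine KZ.of_sub_of_mem_relations_of_null r r₂ ?_ hnull fun z hz => hri hz.1
    rw [Set.sdiff_eq_empty.mpr hsub, measure_empty]
  have hmap : ∀ {c : (Fin N → ℝ) → ℝ}, IsSemialgebraicFunOn ℚ τ c →
      (∀ x ∈ τ, c x ∈ Icc (a x) (b x)) →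
      IsSemialgebraicFunOn ℚ τ (fun x => F (Fin.snoc x (c x))) := by
    intro c hc hcm
    have hφ : IsSemialgebraicMapOn ℚ τ (fun x => (Fin.snoc x (c x) : Fin (N + 1) → ℝ)) := by
      refine IsSemialgebraicMapOn.of_forall hτ fun j => ?_
      refine Fin.lastCases ?_ (fun i => ?_) j
      · simpa using hc
      · simpa using isSemialgebraicFunOn_apply hτ i
    exact IsSemialgebraicFunOn.comp_isSemialgebraicMapOn_holds hF hφ
      fun x hx => KZlog.snoc_mem_band.mpr ⟨hx, hcm x hx⟩
  have hgsa : IsSemialgebraicFunOn ℚ τ (fun x => F (Fin.snoc x (b x)) - F (Fin.snoc x (a x))) :=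
    IsSemialgebraicFunOn.sub_holds (hmap hb fun x hx => Set.right_mem_Icc.mpr (hab x hx).le)
      (hmap ha fun x hx => Set.left_mem_Icc.mpr (hab x hx).le)
  set G : (Fin (N + 1) → ℝ) → ℝ := (KZlog.band τ a b).indicator f with hG_def
  have hG : Integrable G := (integrable_indicator_iff hBm).mpr hfB
  obtain ⟨e, he, he_symm⟩ := exists_measurableEquiv_snoc N
  have hG2 : Integrable (fun q : (Fin N → ℝ) × ℝ => G (Fin.snoc q.1 q.2))
      ((volume : Measure (Fin N → ℝ)).prod (volume : Measure ℝ)) := by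
    have h := ((he.symm e).integrable_comp_emb e.symm.measurableEmbedding (g := G)).mpr hG
    convert h using 1
    ext q
    simp [he_symm]
  have hfib_in : ∀ x ∈ τ, (fun t => G (Fin.snoc x t)) =
      (Icc (a x) (b x)).indicator (fun t => f (Fin.snoc x t)) := by
    intro x hx
    ext t
    by_cases ht : t ∈ Icc (a x) (b x)
    · rw [indicator_of_mem ht, hG_def, indicator_of_mem (KZlog.snoc_mem_band.mpr ⟨hx, ht⟩)]
    · rw [indicator_of_notMem ht, hG_def,
        indicator_of_notMem (fun h => ht (KZlog.snoc_mem_band.mp h).2)]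
  have hgx : ∀ x ∈ τ, Integrable (fun t => G (Fin.snoc x t)) →
      F (Fin.snoc x (b x)) - F (Fin.snoc x (a x)) = ∫ t, G (Fin.snoc x t) := by
    intro x hx hxi
    rw [hfib_in x hx, integral_indicator measurableSet_Icc, integral_Icc_eq_integral_Ioc,
      ← intervalIntegral.integral_of_le (hab x hx).le]
    refine (intervalIntegral.integral_eq_sub_of_hasDerivAt_of_le (hab x hx).le (hcont x hx)
      (hder x hx) ?_).symm
    rw [intervalIntegrable_iff_integrableOn_Icc_of_le (hab x hx).le]
    have h' := hxi
    rw [hfib_in x hx] at h'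
    exact (integrable_indicator_iff measurableSet_Icc).mp h'
  have hgi : IntegrableOn (fun x => F (Fin.snoc x (b x)) - F (Fin.snoc x (a x))) τ := by
    refine Integrable.mono' hG2.integral_norm_prod_left.integrableOn.integrable
      (KZ.aestronglyMeasurable_of_isSemialgebraicFunOn hgsa hτm) ?_
    rw [ae_restrict_iff' hτm]
    filter_upwards [hG2.prod_right_ae] with x hx hxτ
    rw [hgx x hxτ hx]
    exact norm_integral_le_integral_norm _
  let r' : KZ.IntegralRep N :=
    ⟨τ, fun x => F (Fin.snoc x (b x)) - F (Fin.snoc x (a x)), hτ, hgsa, hgi⟩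
  have h23 : KZ.of r₂ - KZ.of r' ∈ KZ.relations :=
    KZ.newtonLeibnizRel_subset_relations ⟨N, r₂, r', a, b, F, hF, ha, hb,
      fun x hx => (hab x hx).le, rfl, hcont, hder, fun x _ => rfl, rfl⟩
  refine ⟨r', rfl, rfl, ?_⟩; have : KZ.of r - KZ.of r' = (KZ.of r - KZ.of r₂) + (KZ.of r₂ - KZ.of r') := by abel
  rw [this]; exact KZ.relations.add_mem h12 h23

/-- **(E1₄) Newton–Leibniz on `Δ₄` in the last coordinate** (rule 3): every representation of `f = ∂₃F` on `Δ₄` is congruent to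
`[Δ₃, F(t₀,t₁,t₂,t₂) - F(t₀,t₁,t₂,0)]`. [Kontsevich–Zagier 2001 §1.2 rule (3)] -/
theorem nlB4 {f F : (Fin 4 → ℝ) → ℝ} (hf : IsSemialgebraicFunOn ℚ bandB4 f) (hF : IsSemialgebraicFunOn ℚ bandB4 F)
    (hcont : ∀ y ∈ KZ.openOrderedSimplex 3, ContinuousOn (fun t => F (Fin.snoc y t)) (Icc 0 (y (Fin.last 2))))
    (hder : ∀ y ∈ KZ.openOrderedSimplex 3, ∀ t ∈ Ioo 0 (y (Fin.last 2)),
      HasDerivAt (fun s => F (Fin.snoc y s)) (f (Fin.snoc y t)) t)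
    (r : KZ.IntegralRep 4) (hd : r.domain = KZ.openOrderedSimplex 4) (hi : EqOn r.integrand f r.domain) :
    ∃ r' : KZ.IntegralRep 3, r'.domain = KZ.openOrderedSimplex 3 ∧
      (r'.integrand = fun y => F (Fin.snoc y (y (Fin.last 2))) - F (Fin.snoc y 0)) ∧
      KZ.of r - KZ.of r' ∈ KZ.relations := by
  have hτ := KZ.isSemialgebraic_openOrderedSimplex 3
  have ha : IsSemialgebraicFunOn ℚ (KZ.openOrderedSimplex 3) (fun _ : Fin 3 → ℝ => (0 : ℝ)) :=
    (isSemialgebraicFunOn_aeval hτ (0 : MvPolynomial (Fin 3) ℚ)).congr fun y _ => by simp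
  have hb : IsSemialgebraicFunOn ℚ (KZ.openOrderedSimplex 3) (fun y : Fin 3 → ℝ => y (Fin.last 2)) :=
    (isSemialgebraicFunOn_aeval hτ (MvPolynomial.X (Fin.last 2))).congr fun y _ => by simp
  have hab : ∀ y ∈ KZ.openOrderedSimplex 3, (fun _ : Fin 3 → ℝ => (0 : ℝ)) y < (fun y : Fin 3 → ℝ => y (Fin.last 2)) y :=
    fun y hy => ((mem_simplex_three_iff y).1 hy).1
  exact newtonLeibniz_pack4 hτ ha hb hab hf hF hcont hder r (by rw [hd]; exact simplex4_eq_openBand) hi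

/-! ### §L2 The layer integrand, the incomplete-Beta primitive, and the `t₃`-DISPOSAL ENGINE -/

/-- the layer integrand with explicit exponents (verbatim the shape of `IsLayerFour`):
`q·g₀^{κ₀} g₁^{κ₁} g₂^{κ₂} g₃^{κ₃} g₄^{κ₄}/(t₀^{β₀} t₁^{β₁} t₂^{β₂} (1-t₁)^{γ₁} (1-t₂)^{γ₂} (1-t₃)^{γ₃} (t₀-t₂)^{α₀₂} (t₀-t₃)^{α₀₃} (t₁-t₃)^{α₁₃})` -/
def lay (q : ℚ) (κ0 κ1 κ2 κ3 κ4 β0 β1 β2 γ1 γ2 γ3 α02 α03 α13 : ℕ) (t : Fin 4 → ℝ) : ℝ :=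
  (q : ℝ) * ((1 - t 0) ^ κ0 * (t 0 - t 1) ^ κ1 * (t 1 - t 2) ^ κ2 * (t 2 - t 3) ^ κ3 * t 3 ^ κ4) /
    (t 0 ^ β0 * t 1 ^ β1 * t 2 ^ β2 * (1 - t 1) ^ γ1 * (1 - t 2) ^ γ2 * (1 - t 3) ^ γ3 * (t 0 - t 2) ^ α02 * (t 0 - t 3) ^ α03 *
      (t 1 - t 3) ^ α13)

/-- `IsLayerFour` unfolded through `lay` -/
theorem isLayerFour_iff (s : KZ.IntegralRep 4) : IsLayerFour s ↔ s.domain = simplex 4 ∧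
    ∃ (q : ℚ) (κ0 κ1 κ2 κ3 κ4 β0 β1 β2 γ1 γ2 γ3 α02 α03 α13 : ℕ),
      EqOn s.integrand (lay q κ0 κ1 κ2 κ3 κ4 β0 β1 β2 γ1 γ2 γ3 α02 α03 α13) s.domain :=
  Iff.rfl

/-- coefficients of the incomplete-Beta primitive `∫₀^{t₃} (t₂-s)^{κ₃} s^{κ₄} ds = ∑ₘ ibC m · t₂^{κ₃-m} t₃^{κ₄+m+1}` -/
def ibC (κ3 κ4 m : ℕ) : ℚ := (-1) ^ m * (κ3.choose m : ℚ) / ((κ4 : ℚ) + m + 1)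

/-- its value on the face `t₃ = t₂` per `t₂^{κ₃+κ₄+1}` (`= B(κ₃+1, κ₄+1)`) -/
def ibS (κ3 κ4 : ℕ) : ℚ := ∑ m ∈ Finset.range (κ3 + 1), ibC κ3 κ4 m

/-- `∂₃` of the primitive is the integrand (binomial theorem) -/
theorem ib_deriv (κ3 κ4 : ℕ) (a t : ℝ) :
    ∑ m ∈ Finset.range (κ3 + 1), (ibC κ3 κ4 m : ℝ) * a ^ (κ3 - m) * (((κ4 + m + 1 : ℕ) : ℝ) * t ^ (κ4 + m)) =
      (a - t) ^ κ3 * t ^ κ4 := by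
  rw [sub_eq_neg_add, add_pow, Finset.sum_mul]; refine Finset.sum_congr rfl fun m _ => ?_
  have hne : ((κ4 : ℝ) + m + 1) ≠ 0 := by positivity
  rw [ibC, neg_pow]; push_cast; field_simp; ring

end Summit.KontsevichZagierPeriods.KontsevichZagierPeriods.Cruxes.GZNormalFormWThree.GZLadder.LayerFour
end
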